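import Literature.Computability.Complexity.Hastad3SatGame
import Literature.Computability.Complexity.CNFInvariance
import HarnessLib

/-!
# Håstad's 3-SAT test as an E3-CNF: folded long-code variables, weighted clauses (Thm 6.5, formula level)

Håstad, *Some optimal inapproximability results*, J. ACM 48 (2001), proof of Thm 6.5 with Thm 5.4
("we create an instance … by for each random string of the verifier writing down the test as a
constraint, with weight the probability of the string; weights are turned into multiplicities"),
for the test `3S^ε` run on a unit-weight projection game `G` (`Hastad3SatGame.lean`):

* **Variables** are the entries of the tables FOLDED OVER TRUE (Håstad 2001, Def. 2.30–2.31): for each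
  vertex `u` of Alice one Boolean variable `nA u f` for every `f : α → Bool` with `f (xA u) = false`
  (the representative of the pair `{f, ¬f}`), and for each vertex `v` of Bob one variable `nB v g` for
  every `g : Lab v → Bool` with `g (yB v) = false`; the table read off an assignment `σ`
  (`tabA σ u f = σ(nA u f)` or `¬σ(nA u ¬f)`) is folded by construction (`isFolded_tabA`), and the
  literal `litA u f` is true under `σ` iff `tabA σ u f` is (`eval_litA`).
* **Clauses**: for every edge `e` (from `v = src e` to `u = dst e`) and every triple `(f, g₁, fl)` the
  clause `A_u(f) ∨ B_v(g₁) ∨ B_v(g₂)`, `g₂ = g₁ ⊕ mask`, repeated `mult` times, where for a RATIONAL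
  `ε = p/q` the weight `2^{-|α|} 2^{-K} · flipWt` of the triple (`K = |Lab v|`) is made integral and
  uniform across edges as `mult = p^{#flips} (q - p)^{K - #flips} (2q)^{K⋆ - K}` (`K ≤ K⋆`); triples
  whose mask is identically false (`g₂ = g₁`, clause of width two) or identically true (`g₂ = ¬g₁`,
  a tautology) are **dropped**, so that every clause has three literals on three distinct variables
  (`isExactWidth_hCNF`).  The effect of the dropped clauses on the value is accounted for in
  `Hastad3SatCNFSound.lean`.
* **Completeness** (`satisfiable_hCNF`): perfect strategies of `G` give a satisfying assignment (the
  long codes; every kept clause is an instance of the test, accepted by Lemma 6.6).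

The numberings `nA`, `nB` are parameters (any injective, disjoint numbering will do: a machine
rendering may use its own, cf. `CNFInvariance.lean`).

## References

* J. Håstad, *Some optimal inapproximability results*, J. ACM 48 (2001) 798–859: Def. 2.30–2.31
  (folding), §5 proof of Thm 5.4 (tests as weighted constraints), §6.1 proof of Thm 6.5 [Hastad2001].
-/

noncomputable section

namespace Literature.Computability.Complexity

namespace ProjGame

open Finset Literature.Probability.RandomGraphs.LowDegree Literature.Computability.Complexity.LongCode
  Literature.Computability.Complexity.Hastad3Sat

variable {E V U β α : Type} (G : ProjGame E V U β α)

/-- The data of the CNF rendering of Håstad's test on `G`: the rational noise `ε = p/q`, base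
points for folding, numberings of the folded table entries, and a common bound `K⋆` on the label
sets of Bob. [cite: Hastad2001, §6.1 (proof of Thm 6.5)] -/
structure CNFData where
  /-- numerator of `ε` -/
  p : ℕ
  /-- denominator of `ε` -/
  q : ℕ
  /-- `p ≤ q` -/
  p_le : p ≤ q
  /-- base point of Alice's label cube at `u` (folding) -/
  xA : U → α
  /-- base point of Bob's admissible labels at `v` (folding) -/
  yB : ∀ v, G.Lab v
  /-- variable number of Alice's table entry `(u, f)` -/
  nA : U → (α → Bool) → ℕ
  /-- variable number of Bob's table entry `(v, g)` -/
  nB : ∀ v, (G.Lab v → Bool) → ℕ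
  /-- a common bound on `|Lab v|` -/
  Kstar : ℕ

variable {G}

namespace CNFData

variable (D : G.CNFData)

/-! ### Folded variables and literals -/

/-- Alice's table at `u` read off an assignment, folded over true: `A_u(f) = σ(nA u f)` if
`f (xA u) = false`, else `¬σ(nA u ¬f)`. [cite: Hastad2001, Def. 2.31] -/
def tabA (σ : ℕ → Bool) (u : U) (f : α → Bool) : Bool :=
  if f (D.xA u) then !σ (D.nA u fun x => !f x) else σ (D.nA u f)

/-- Bob's table at `v` read off an assignment, folded over true. [cite: Hastad2001, Def. 2.31] -/
def tabB (σ : ℕ → Bool) (v : V) (g : G.Lab v → Bool) : Bool :=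
  if g (D.yB v) then !σ (D.nB v fun y => !g y) else σ (D.nB v g)

/-- The literal standing for `A_u(f)`. [cite: Hastad2001, Def. 2.31 (access to a folded table)] -/
def litA (u : U) (f : α → Bool) : Literal ℕ :=
  if f (D.xA u) then (D.nA u fun x => !f x, false) else (D.nA u f, true)

/-- The literal standing for `B_v(g)`. [cite: Hastad2001, Def. 2.31] -/
def litB (v : V) (g : G.Lab v → Bool) : Literal ℕ :=
  if g (D.yB v) then (D.nB v fun y => !g y, false) else (D.nB v g, true)

/-- The folded table of Alice is folded. [cite: Hastad2001, Def. 2.31] -/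
theorem isFolded_tabA (σ : ℕ → Bool) (u : U) : IsFolded (D.tabA σ u) := by
  intro f
  unfold tabA
  simp only [Bool.not_not]
  cases f (D.xA u) <;> simp

/-- The folded table of Bob is folded. [cite: Hastad2001, Def. 2.31] -/
theorem isFolded_tabB (σ : ℕ → Bool) (v : V) : IsFolded (D.tabB σ v) := by
  intro g
  unfold tabB
  simp only [Bool.not_not]
  cases g (D.yB v) <;> simp

/-- The literal `litA u f` is true under `σ` iff `A_u(f)` is. [cite: Hastad2001, Def. 2.31] -/
theorem eval_litA (σ : ℕ → Bool) (u : U) (f : α → Bool) :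
    Literal.eval σ (D.litA u f) = D.tabA σ u f := by
  unfold litA tabA Literal.eval
  cases f (D.xA u) <;> simp

/-- The literal `litB v g` is true under `σ` iff `B_v(g)` is. [cite: Hastad2001, Def. 2.31] -/
theorem eval_litB (σ : ℕ → Bool) (v : V) (g : G.Lab v → Bool) :
    Literal.eval σ (D.litB v g) = D.tabB σ v g := by
  unfold litB tabB Literal.eval
  cases g (D.yB v) <;> simp

/-- The variable of `litA u f` is `nA u` of the representative of `{f, ¬f}`. [folklore] -/
theorem litA_fst (u : U) (f : α → Bool) :
    (D.litA u f).1 = D.nA u (if f (D.xA u) then (fun x => !f x) else f) := by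
  unfold litA; cases f (D.xA u) <;> rfl

/-- The variable of `litB v g` is `nB v` of the representative of `{g, ¬g}`. [folklore] -/
theorem litB_fst (v : V) (g : G.Lab v → Bool) :
    (D.litB v g).1 = D.nB v (if g (D.yB v) then (fun y => !g y) else g) := by
  unfold litB; cases g (D.yB v) <;> rfl

/-- The representative takes the value `false` at the base point. [folklore] -/
theorem rep_base (v : V) (g : G.Lab v → Bool) :
    (if g (D.yB v) then (fun y => !g y) else g) (D.yB v) = false := by
  cases h : g (D.yB v) <;> simp [h]

/-! ### Test triples, masks, clauses, multiplicities -/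

/-- A test triple: an edge `e` and `(f, g₁, fl)` on the cubes of `dst e` and `src e`.
[cite: Hastad2001, §6.1 (random string of Test 3S)] -/
abbrev Trip (G : ProjGame E V U β α) : Type :=
  Σ e : E, (α → Bool) × (G.Lab (G.src e) → Bool) × (G.Lab (G.src e) → Bool)

/-- The canonical membership of an edge among the edges at its source. [folklore] -/
def edgeAt (e : E) : G.EdgeAt (G.src e) := ⟨e, rfl⟩

/-- The mask of a triple. [cite: Hastad2001, §6.1 (Test 3S, step 4)] -/
def maskT (t : Trip G) : G.Lab (G.src t.1) → Bool := mask (G.tproj (G.src t.1) (edgeAt t.1)) t.2.1 t.2.2.2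

/-- The clause of a triple: `A_{dst e}(f) ∨ B_{src e}(g₁) ∨ B_{src e}(g₁ ⊕ mask)`.
[cite: Hastad2001, §6.1 (Test 3S, step 5)] -/
def clauseT (t : Trip G) : Clause ℕ :=
  [D.litA (G.dst t.1) t.2.1, D.litB (G.src t.1) t.2.2.1, D.litB (G.src t.1) (shift t.2.2.1 (maskT t))]

/-- A triple is **nondegenerate** if its mask is neither identically false (`g₂ = g₁`) nor
identically true (`g₂ = ¬g₁`). [cite: Hastad2001, §6.1] -/
def Nondeg (t : Trip G) : Prop := (∃ y, maskT t y = true) ∧ ∃ y, maskT t y = false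

/-- Nondegeneracy is decidable. [folklore] -/
instance instDecidablePredNondeg [Fintype E] [Fintype β] [DecidableEq V] : DecidablePred (Nondeg (G := G)) :=
  fun _ => inferInstanceAs (Decidable (_ ∧ _))

/-- The multiplicity of a triple: `p^{#flips} (q - p)^{K - #flips} (2q)^{K⋆ - K}`, `K = |Lab (src e)|`.
[cite: Hastad2001, §5 (proof of Thm 5.4: weights as multiplicities)] -/
def mult [Fintype E] [Fintype β] [DecidableEq V] (t : Trip G) : ℕ :=
  D.p ^ (univ.filter fun y => t.2.2.2 y = true).card *
    (D.q - D.p) ^ (univ.filter fun y => t.2.2.2 y = false).card *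
      (2 * D.q) ^ (D.Kstar - Fintype.card (G.Lab (G.src t.1)))

/-- **The E3-CNF of Håstad's test on `G`**: the clauses of the nondegenerate triples with their
multiplicities. [cite: Hastad2001, §6.1 (proof of Thm 6.5)] -/
def hCNF [Fintype E] [Fintype β] [Fintype α] [DecidableEq V] [DecidableEq β] [DecidableEq α] : CNF ℕ :=
  ((univ : Finset (Trip G)).filter Nondeg).toList.flatMap fun t => List.replicate (D.mult t) (D.clauseT t)

/-! ### Exact width three -/

/-- Injectivity and disjointness of the numberings (on all functions; only representatives are used).
[folklore] -/
structure GoodNumbering : Prop where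
  /-- `nA` is injective -/
  injA : ∀ u u' f f', D.nA u f = D.nA u' f' → u = u' ∧ HEq f f'
  /-- `nB` is injective -/
  injB : ∀ v v' g g', D.nB v g = D.nB v' g' → v = v' ∧ HEq g g'
  /-- the two ranges are disjoint -/
  disj : ∀ u f v g, D.nA u f ≠ D.nB v g

/-- For a nondegenerate mask `m`, `g ⊕ m ∉ {g, ¬g}`, so the representatives of `g` and `g ⊕ m` differ.
[cite: Hastad2001, §6.1] -/
theorem rep_shift_ne {v : V} (g m : G.Lab v → Bool) (h1 : ∃ y, m y = true) (h0 : ∃ y, m y = false) :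
    (if g (D.yB v) then (fun y => !g y) else g) ≠
      (if (shift g m) (D.yB v) then (fun y => !(shift g m) y) else shift g m) := by
  obtain ⟨y1, hy1⟩ := h1
  obtain ⟨y0, hy0⟩ := h0
  intro h
  cases hg : g (D.yB v) <;> cases hs : shift g m (D.yB v) <;> simp only [hg, hs, if_true, if_false,
    Bool.false_eq_true] at h
  · have := congrFun h y1; simp [hy1] at this
  · have := congrFun h y0; simp [hy0] at this
  · have := congrFun h y0; simp [hy0] at this
  · have := congrFun h y1; simp [hy1] at this

/-- **Every clause has exactly three literals on three distinct variables.**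
[cite: Hastad2001, Thm 6.5 (E3-CNF)] -/
theorem isExactWidth_hCNF [Fintype E] [Fintype β] [Fintype α] [DecidableEq V] [DecidableEq β]
    [DecidableEq α] (hD : D.GoodNumbering) : (D.hCNF).IsExactWidth 3 := by
  intro c hc
  unfold hCNF at hc
  rw [List.mem_flatMap] at hc
  obtain ⟨t, ht, hct⟩ := hc
  rw [List.mem_replicate] at hct
  obtain ⟨-, rfl⟩ := hct
  rw [mem_toList, mem_filter] at ht
  obtain ⟨-, h1, h0⟩ := ht
  refine ⟨rfl, ?_⟩
  have hxy : (D.litA (G.dst t.1) t.2.1).1 ≠ (D.litB (G.src t.1) t.2.2.1).1 := by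
    rw [litA_fst, litB_fst]; exact hD.disj _ _ _ _
  have hxz : (D.litA (G.dst t.1) t.2.1).1 ≠ (D.litB (G.src t.1) (shift t.2.2.1 (maskT t))).1 := by
    rw [litA_fst, litB_fst]; exact hD.disj _ _ _ _
  have hyz : (D.litB (G.src t.1) t.2.2.1).1 ≠ (D.litB (G.src t.1) (shift t.2.2.1 (maskT t))).1 := by
    rw [litB_fst, litB_fst]
    intro h
    obtain ⟨-, hh⟩ := hD.injB _ _ _ _ h
    exact D.rep_shift_ne _ _ h1 h0 (eq_of_heq hh)
  simp [clauseT, hxy, hxz, hyz]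

/-! ### Completeness -/

/-- The value of the clause of a triple under `σ` is the acceptance indicator of the test on the
folded tables read off `σ`. [cite: Hastad2001, §6.1 (Test 3S, step 5)] -/
theorem eval_clauseT (σ : ℕ → Bool) (t : Trip G) :
    Clause.eval σ (D.clauseT t) =
      (D.tabA σ (G.dst t.1) t.2.1 || D.tabB σ (G.src t.1) t.2.2.1 ||
        D.tabB σ (G.src t.1) (shift t.2.2.1 (maskT t))) := by
  simp [clauseT, Clause.eval, eval_litA, eval_litB, Bool.or_assoc]

/-- An assignment writing the long codes of perfect strategies `b, a` into the folded variables
satisfies the clause of every triple. [cite: Hastad2001, Lemma 6.6 and Lemma 6.12] -/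
theorem eval_clauseT_of_longCode {σ : ℕ → Bool} {b : V → β} {a : U → α}
    (hsat : ∀ e, G.proj e (b (G.src e)) = some (a (G.dst e)))
    (hA : ∀ u f, D.tabA σ u f = f (a u))
    (hB : ∀ v g, D.tabB σ v g = g ⟨b v, G.adm_of_sat hsat v⟩) (t : Trip G) :
    Clause.eval σ (D.clauseT t) = true := by
  rw [eval_clauseT, hA, hB, hB]
  have hx : a (G.dst t.1) = G.tproj (G.src t.1) (edgeAt t.1) ⟨b (G.src t.1), G.adm_of_sat hsat _⟩ :=
    (G.tproj_sat hsat (G.src t.1) (edgeAt t.1)).symm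
  rw [hx]
  have h := accInd_longCode (G.tproj (G.src t.1) (edgeAt t.1)) ⟨b (G.src t.1), G.adm_of_sat hsat _⟩
    t.2.1 t.2.2.1 t.2.2.2
  unfold accInd at h
  by_contra hne
  rw [Bool.not_eq_true] at hne
  unfold maskT at *
  rw [hne] at h
  simp at h

/-- **Completeness**: if `G` has perfect strategies and the numbering is good, the CNF is satisfiable —
write the long codes into the variables. [cite: Hastad2001, Lemma 6.12 (completeness of F3S^δ)] -/
theorem satisfiable_hCNF [Fintype E] [Fintype β] [Fintype α] [DecidableEq V] [DecidableEq β]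
    [DecidableEq α] (hD : D.GoodNumbering) {b : V → β} {a : U → α}
    (hsat : ∀ e, G.proj e (b (G.src e)) = some (a (G.dst e))) : (D.hCNF).Satisfiable := by
  classical
  -- the assignment: `nA u f ↦ f (a u)`, `nB v g ↦ g (b v)` (on representatives; anything elsewhere)
  let σ : ℕ → Bool := fun x =>
    if h : ∃ u f, D.nA u f = x then (Classical.choose (Classical.choose_spec h)) (a (Classical.choose h))
    else if h' : ∃ v g, D.nB v g = x then
      (Classical.choose (Classical.choose_spec h')) ⟨b (Classical.choose h'), G.adm_of_sat hsat _⟩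
    else false
  have hσA : ∀ u f, σ (D.nA u f) = f (a u) := by
    intro u f
    have h : ∃ u' f', D.nA u' f' = D.nA u f := ⟨u, f, rfl⟩
    simp only [σ, dif_pos h]
    have hs := Classical.choose_spec (Classical.choose_spec h)
    obtain ⟨hu, hf⟩ := hD.injA _ _ _ _ hs
    have key : ∀ (uu : U) (ff : α → Bool), uu = u → HEq ff f → ff (a uu) = f (a u) := by
      rintro uu ff rfl hff; rw [eq_of_heq hff]
    exact key _ _ hu hf
  have hσB : ∀ v g, σ (D.nB v g) = g ⟨b v, G.adm_of_sat hsat v⟩ := by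
    intro v g
    have hn : ¬ ∃ u f, D.nA u f = D.nB v g := fun ⟨u, f, h⟩ => hD.disj u f v g h
    have h' : ∃ v' g', D.nB v' g' = D.nB v g := ⟨v, g, rfl⟩
    simp only [σ, dif_neg hn, dif_pos h']
    have hs := Classical.choose_spec (Classical.choose_spec h')
    obtain ⟨hv, hg⟩ := hD.injB _ _ _ _ hs
    have key : ∀ (vv : V) (gg : G.Lab vv → Bool), vv = v → HEq gg g →
        gg ⟨b vv, G.adm_of_sat hsat vv⟩ = g ⟨b v, G.adm_of_sat hsat v⟩ := by
      rintro vv gg rfl hgg; rw [eq_of_heq hgg]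
    exact key _ _ hv hg
  have hA : ∀ u f, D.tabA σ u f = f (a u) := by
    intro u f
    unfold tabA
    cases f (D.xA u) <;> simp [hσA]
  have hB : ∀ v g, D.tabB σ v g = g ⟨b v, G.adm_of_sat hsat v⟩ := by
    intro v g
    unfold tabB
    cases g (D.yB v) <;> simp [hσB]
  refine ⟨σ, ?_⟩
  unfold CNF.eval hCNF
  rw [List.all_eq_true]
  intro c hc
  rw [List.mem_flatMap] at hc
  obtain ⟨t, -, hct⟩ := hc
  rw [List.mem_replicate] at hct
  obtain ⟨-, rfl⟩ := hct
  exact D.eval_clauseT_of_longCode hsat hA hB t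

end CNFData

end ProjGame

end Literature.Computability.Complexity

end
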